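import Literature.Geometry.Kaehler.HolomorphicLineBundle
import Literature.Geometry.Kaehler.PluriharmonicLog

/-!
# Route NikulinTwinTransport — `LefschetzOneOneK3`, `∂∂̄`–exponential line: the cocycle construction

Helper file for the route item `LefschetzOneOneK3` (Lefschetz's theorem on `(1,1)`-classes for
projective K3 surfaces on the real carriers), continuing the `∂∂̄`–exponential line of
`NikulinTwinTransportLefschetzOneOneK3Holomorphy.lean`. The analytic heart of Lefschetz `(1,1)` in
Chern–Weil form asks, for an integral class `β = e₀[ω]` represented by a closed real `(1,1)`-form
`ω` on a compact complex manifold `M`, for a Hermitian holomorphic line bundle presented by a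
cocycle (`Literature.Geometry.Kaehler.HolomorphicLineBundle`) whose Chern form IS `ω`
(`HermitianMetric.IsChernForm`). This file proves the last, purely algebraic step of the
Čech–`∂̄` construction of that bundle (Weil 1952 / Griffiths–Harris p. 163, rank one Koszul–Malgrange):

**`exists_holomorphicLineBundle_isChernForm_of_expData`.** Let `(U_i)` be an open cover of `M`,
`φ_i : M → ℂ` real-`C^∞` on `U_i`, `f_ij : M → ℝ` and INTEGERS `n_ijk` such that
`u_ij = φ_i − φ_j − f_ij` is holomorphic on `U_i ∩ U_j` and `f_ij + f_jk − f_ik = n_ijk` on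
`U_i ∩ U_j ∩ U_k`; and let `ω` be a `2`-form with `ω = −d((d Im φ_i) ∘ J)` at the points of `U_i`
(this is `ω = 2i ∂∂̄ Im φ_i = ∂∂̄(φ_i − φ̄_i)`, the shape delivered by the zigzag
`ω = dα_i`, `α_i^{0,1} = ∂̄φ_i`, `α_i` real). Then the cocycle `g_ij = exp(2πi u_ij)` is a
holomorphic line bundle `L` on the cover `(U_i)`, `h_i = exp(−4π Im φ_i)` is a Hermitian metric on
it (`h_i = |g_ij|² h_j` because `f_ij` is real), and `ω` is its Chern form:
`(1/4π) d((d log h_i) ∘ J) = −d((d Im φ_i) ∘ J) = ω` on `U_i`.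

Everything here is proved; the inputs `φ_i, f_ij, n_ijk` are produced from a closed real
`(1,1)`-form by the Poincaré and `∂̄`-Poincaré lemmas on a chart-convex cover and the integrality
of the class (companion files).
-/

noncomputable section

open scoped Manifold ContDiff Topology
open Set
open Literature.Geometry.Kaehler

namespace Summit.HodgeConjecture.HodgeConjecture.Theorems

section Cocycle

variable {ι : Type*} {E : Type*} [NormedAddCommGroup E] [NormedSpace ℂ E]
  {M : Type*} [TopologicalSpace M] [ChartedSpace E M]

/-- `α ↦ α ∘ J` commutes with real scalars. [folklore] -/
theorem compJ_smul {F : Type*} [NormedAddCommGroup F] [NormedSpace ℝ F] (c : ℝ)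
    (α : MForm 𝓘(ℝ, E) M F 1) : (c • α).compJ = c • α.compJ := by
  funext x
  ext v
  rfl

/-- The `0`-form of a real multiple of a real function (cast to `ℂ`) is the real multiple of the
`0`-form. [folklore] -/
theorem ofFun_ofReal_const_mul (c : ℝ) (g : M → ℝ) :
    (MForm.ofFun 𝓘(ℝ, E) fun y ↦ ((c * g y : ℝ) : ℂ)) =
      c • MForm.ofFun 𝓘(ℝ, E) fun y ↦ ((g y : ℝ) : ℂ) := by
  funext x
  ext v
  simp only [MForm.ofFun_apply, Pi.smul_apply, ContinuousAlternatingMap.smul_apply,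
    Complex.ofReal_mul, Complex.real_smul]

/-- The real part of `2πi u` is `−2π Im u`. [folklore] -/
theorem re_two_pi_I_mul (u : ℂ) : (2 * Real.pi * Complex.I * u).re = -(2 * Real.pi * u.im) := by
  simp [Complex.mul_re, Complex.mul_im]

/-- `‖exp(2πi u)‖² = exp(−4π Im u)`. [folklore] -/
theorem norm_exp_two_pi_I_mul_sq (u : ℂ) :
    ‖Complex.exp (2 * Real.pi * Complex.I * u)‖ ^ 2 = Real.exp (-(4 * Real.pi) * u.im) := by
  rw [Complex.norm_exp, re_two_pi_I_mul, sq, ← Real.exp_add]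
  congr 1
  ring

/-- `exp(2πi (z − n)) = exp(2πi z)` for an integer `n`. [folklore] -/
theorem exp_two_pi_I_mul_sub_int (z : ℂ) (n : ℤ) :
    Complex.exp (2 * Real.pi * Complex.I * (z - n)) = Complex.exp (2 * Real.pi * Complex.I * z) := by
  rw [mul_sub, Complex.exp_sub, show 2 * (Real.pi : ℂ) * Complex.I * n = n * (2 * Real.pi * Complex.I) by ring,
    Complex.exp_int_mul_two_pi_mul_I, div_one]

/-- **The Chern form of the metric `h = e^{−4π F}` in a frame is `−d((dF) ∘ J)`**:
`(1/4π) d((d log e^{−4πF}) ∘ J) = (1/4π) d((d(−4πF)) ∘ J) = −d((dF) ∘ J)` (linearity of `d` and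
of `∘ J` over real constants; Voisin I §3.3.1 with `log h = −4πF`).
[cite: VoisinHodgeI2002, §3.3.1] -/
theorem smul_mextDeriv_compJ_mextDeriv_log_exp (F : M → ℝ) :
    (1 / (4 * Real.pi)) • mextDeriv (mextDeriv (MForm.ofFun 𝓘(ℝ, E) fun y ↦
        (Real.log (Real.exp (-(4 * Real.pi) * F y)) : ℂ))).compJ =
      -mextDeriv (mextDeriv (MForm.ofFun 𝓘(ℝ, E) fun y ↦ ((F y : ℝ) : ℂ))).compJ := by
  have hlog : (fun y ↦ (Real.log (Real.exp (-(4 * Real.pi) * F y)) : ℂ)) =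
      fun y ↦ (((-(4 * Real.pi)) * F y : ℝ) : ℂ) := by
    funext y
    rw [Real.log_exp]
  rw [hlog, ofFun_ofReal_const_mul, mextDeriv_smul, compJ_smul, mextDeriv_smul, smul_smul]
  have hπ : (1 / (4 * Real.pi)) * (-(4 * Real.pi)) = -1 := by
    field_simp
  rw [hπ, neg_one_smul]

/-- **The cocycle construction (rank-one Koszul–Malgrange / Weil, algebraic step).** From an open
cover `(U_i)`, functions `φ_i : M → ℂ` real-`C^∞` on `U_i`, real `f_ij` and integers `n_ijk` with
`u_ij = φ_i − φ_j − f_ij` holomorphic on `U_i ∩ U_j` and `f_ij + f_jk − f_ik = n_ijk` on triple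
overlaps, and a `2`-form `ω` with `ω = −d((d Im φ_i) ∘ J)` at the points of `U_i`: the cocycle
`g_ij = exp(2πi u_ij)` on the cover `(U_i)` is a holomorphic line bundle carrying the Hermitian
metric `h_i = exp(−4π Im φ_i)`, and `ω` is its Chern form (`IsChernForm`).
[cite: VoisinHodgeI2002, §3.3.1 and Thm. 4.49] [cite: GriffithsHarris1978, p. 163 (proof of the Lefschetz theorem on (1,1)-classes)] -/
theorem exists_holomorphicLineBundle_isChernForm_of_expData
    (U : ι → Set M) (hUo : ∀ i, IsOpen (U i)) (hUc : ∀ x, ∃ i, x ∈ U i)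
    (φ : ι → M → ℂ) (f : ι → ι → M → ℝ) (n : ι → ι → ι → ℤ)
    (hφ : ∀ i, ContMDiffOn 𝓘(ℝ, E) 𝓘(ℝ, ℂ) ∞ (φ i) (U i))
    (hu : ∀ i j, MDifferentiableOn 𝓘(ℂ, E) 𝓘(ℂ, ℂ) (fun x ↦ φ i x - φ j x - f i j x) (U i ∩ U j))
    (hn : ∀ i j k, ∀ x ∈ U i ∩ U j ∩ U k, f i j x + f j k x - f i k x = n i j k)
    (ω' : MForm 𝓘(ℝ, E) M ℂ 2)
    (hω : ∀ i, ∀ x ∈ U i, ω' x =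
      -(mextDeriv (mextDeriv (MForm.ofFun 𝓘(ℝ, E) fun y ↦ (((φ i y).im : ℝ) : ℂ))).compJ x)) :
    ∃ (L : HolomorphicLineBundle ι E M) (h : L.HermitianMetric),
      (∀ i, L.baseSet i = U i) ∧ h.IsChernForm ω' := by
  -- the cocycle `g_ij = exp(2πi u_ij)`
  have hexp : Differentiable ℂ fun z : ℂ ↦ Complex.exp (2 * Real.pi * Complex.I * z) :=
    Complex.differentiable_exp.comp (differentiable_id.const_mul _)
  let L : HolomorphicLineBundle ι E M :=
    { baseSet := U
      isOpen_baseSet := hUo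
      exists_mem_baseSet := hUc
      coordChange := fun i j x ↦ Complex.exp (2 * Real.pi * Complex.I * (φ i x - φ j x - f i j x))
      mdifferentiableOn_coordChange := fun i j x hx ↦
        (hexp _).comp_mdifferentiableWithinAt (f := fun x ↦ φ i x - φ j x - f i j x) (hu i j x hx)
      coordChange_ne_zero := fun i j x _ ↦ Complex.exp_ne_zero _
      coordChange_comp := fun i j k x hx ↦ by
        have hsum : (φ i x - φ j x - f i j x) + (φ j x - φ k x - f j k x) =
            (φ i x - φ k x - f i k x) - (n i j k : ℂ) := by
          have h := congrArg (fun r : ℝ ↦ (r : ℂ)) (hn i j k x hx)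
          push_cast at h
          rw [← h]; ring
        rw [← Complex.exp_add, ← mul_add, hsum, exp_two_pi_I_mul_sub_int] }
  -- the metric `h_i = exp(−4π Im φ_i)`
  have hsmooth : ContDiff ℝ ∞ fun z : ℂ ↦ Real.exp (-(4 * Real.pi) * z.im) :=
    Real.contDiff_exp.comp (contDiff_const.mul Complex.imCLM.contDiff)
  let h : L.HermitianMetric :=
    { weight := fun i x ↦ Real.exp (-(4 * Real.pi) * (φ i x).im)
      weight_pos := fun i x _ ↦ Real.exp_pos _
      contMDiffOn_weight := fun i x hx ↦ hsmooth.comp_contMDiffWithinAt (hφ i x hx)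
      weight_eq := fun i j x _ ↦ by
        change Real.exp (-(4 * Real.pi) * (φ i x).im) =
          ‖Complex.exp (2 * Real.pi * Complex.I * (φ i x - φ j x - f i j x))‖ ^ 2 *
            Real.exp (-(4 * Real.pi) * (φ j x).im)
        rw [norm_exp_two_pi_I_mul_sq, ← Real.exp_add]
        congr 1
        simp only [Complex.sub_im, Complex.ofReal_im]
        ring }
  refine ⟨L, h, fun _ ↦ rfl, fun i x hx ↦ ?_⟩
  -- the Chern form in the frame `i` is `−d((d Im φ_i) ∘ J)`
  rw [hω i x hx, HolomorphicLineBundle.HermitianMetric.localChernForm]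
  change _ = ((1 / (4 * Real.pi)) • mextDeriv (mextDeriv (MForm.ofFun 𝓘(ℝ, E) fun y ↦
    (Real.log (Real.exp (-(4 * Real.pi) * (φ i y).im)) : ℂ))).compJ) x
  rw [smul_mextDeriv_compJ_mextDeriv_log_exp, Pi.neg_apply]

end Cocycle

end Summit.HodgeConjecture.HodgeConjecture.Theorems

end
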